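import Summits.AtomisticToContinuum.Crystallization.Theorems.OverbindingBudgetElasticSplitShear
import Summits.AtomisticToContinuum.Crystallization.Theorems.OverbindingBudgetExcessInstability

/-!
# OverbindingBudget — «ElasticSplit» (6): the EOS branch reduced to a PER-SITE virial inequality (decomp-a2c lens-4, g27)

Helper file (`--supports stmt-AtomisticToContinuum-31280`).  File 4 typed the EOS half of the scale cut as `CompressedVirialLaw T₀ D`
(cofinal cubes with dilation gain `≥ κ ℓ³` in every clean texture with a COMPRESSED clean scale) — a statement about large cubes.  Here it
is cut down to a one-site statement a certificate can attack: `siteVirial y G := Σ_{w ∈ G} (|y − w|⁻¹² − |y − w|⁻⁶)` and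
`LocalVirialInequality T₀ D c` := every site `y` of such a texture has `c ≤ siteVirial y G` for every finite `G ⊆ Y` containing the points of
`Y` within `1` of `y` (far terms are NEGATIVE, so this is the full per-site virial `≥ c`, tsum-free); `LocalVirialLaw T₀ D := ∃ c > 0, …` is
KERNEL-STRONGER than `CompressedVirialLaw` (a sufficient certificate, like `ChargedEnergyGap` on the dense branch): near part = twelve bonds
in the compressed RT window (repulsive virial `≥ +3.1`/site at bonds `≤ 0.968`), far part = a packing tail bound (Barlow value `3.00`,
adversary threshold `3.47`, the 16 % margin of the node memo §3).  PROVED here: `compressedVirialLaw_of_localVirialLaw` — in the cube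
`Q(q, ℓ)`, `ℓ = 2m+3`, the `1`-deep sites have `siteVirial ≥ c` (the inequality with `G` = the chunk), the `≤ 162 ℓ²/δ³` face sites have
`siteVirial ≥ −250 δ⁻⁶` (Literature shell sum), and the `9/10`-covering radius plants `≥ m³` distinct deep sites on a `2`-grid; so
`S₁₂ − S₆ = Σ_y siteVirial y F ≥ c ℓ³/128` eventually while `S₁₂ ≤ 250 δ⁻¹²·27 ℓ³/δ³`, whence `dilationGain F ≥ κ ℓ³`.  Cone:
`rdef_of_grossU_localVirial_record : GrossCleanBallsU (1/250) 10 → ChargedEnergyGap → LocalRelaxationTest (1/250) 10 → LocalVirialLaw (1/250) 10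
→ ShearFreeLiouvilleLaw (1/250) 10 → CleanlessExcessT → CoherentResidual 10 → RobustDefectLimitWindows`.
-/

namespace Summit.AtomisticToContinuum.Crystallization.Theorems.OverbindingBudgetElasticSplitLocalVirial

open scoped BigOperators Classical
open Literature.MathematicalPhysics.StatisticalMechanics (UniformlyDiscrete sum_inv_pow_six_le)
open Summit.AtomisticToContinuum.Crystallization.Theses.OverbindingBudget (RobustDefectLimitWindows)
open Summit.AtomisticToContinuum.Crystallization.Theses.PricedLinkCensus (ChargedEnergyGap)
open Summit.AtomisticToContinuum.Crystallization.Theorems.OverbindingBudgetGradedBareness (CleanlessExcessT)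
open Summit.AtomisticToContinuum.Crystallization.Theorems.OverbindingBudgetCoherentCut (CoherentResidual)
open Summit.AtomisticToContinuum.Crystallization.Theorems.OverbindingBudgetUniformCutStatements (GrossCleanBallsU)
open Summit.AtomisticToContinuum.Crystallization.Theorems.OverbindingBudgetCubeTails (card_le_of_separated_of_box)
open Summit.AtomisticToContinuum.Crystallization.Theorems.OverbindingBudgetExcessInstability (finite_inter_cube)
open Summit.AtomisticToContinuum.Crystallization.Theorems.OverbindingBudgetEdgeRelaxationStatements (CleanClass)
open Summit.AtomisticToContinuum.Crystallization.Theorems.OverbindingBudgetElasticSplitStatements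
open Summit.AtomisticToContinuum.Crystallization.Theorems.OverbindingBudgetElasticSplitDilation (enum enum_injective sum_sum_enum)
open Summit.AtomisticToContinuum.Crystallization.Theorems.OverbindingBudgetElasticSplitScale
open Summit.AtomisticToContinuum.Crystallization.Theorems.OverbindingBudgetElasticSplitShear (ShearFreeLiouvilleLaw
  rdef_of_grossU_shearSplit_record)
open Summit.AtomisticToContinuum.Crystallization.Theorems.ContactSaturationLadderDilationCharge (sum_inv_pow_twelve_le_of_separated)

/-- The virial of the site `y` against the finite set `G`: `Σ_{w ∈ G} (|y − w|⁻¹² − |y − w|⁻⁶)` (the term `w = y` vanishes). -/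
noncomputable def siteVirial (y : EuclideanSpace ℝ (Fin 3)) (G : Finset (EuclideanSpace ℝ (Fin 3))) : ℝ :=
  ∑ w ∈ G, ((dist y w)⁻¹ ^ 12 - (dist y w)⁻¹ ^ 6)

/-- **`LocalVirialInequality T₀ D c`**: in every clean texture with a compressed clean scale every site has virial `≥ c` against every
finite part of the texture containing its unit ball (equivalently, far terms being negative: against the whole texture). [piece] -/
def LocalVirialInequality (T₀ D c : ℝ) : Prop :=
  ∀ Y : Set (EuclideanSpace ℝ (Fin 3)), CleanClass T₀ D Y → HasCompressedScale T₀ Y →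
    ∀ y ∈ Y, ∀ G : Finset (EuclideanSpace ℝ (Fin 3)), (↑G : Set (EuclideanSpace ℝ (Fin 3))) ⊆ Y →
      (∀ w ∈ Y, dist y w ≤ 1 → w ∈ G) → c ≤ siteVirial y G

/-- **`LocalVirialLaw T₀ D`** := `∃ c > 0, LocalVirialInequality T₀ D c`; KERNEL-STRONGER than `CompressedVirialLaw T₀ D`. [piece] -/
def LocalVirialLaw (T₀ D : ℝ) : Prop :=
  ∃ c : ℝ, 0 < c ∧ LocalVirialInequality T₀ D c

/-- The chunk virial is the sum of its site virials: `S₁₂(F) − S₆(F) = Σ_{y ∈ F} siteVirial y F`. -/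
theorem invPowSum_sub_eq_sum_siteVirial (F : Finset (EuclideanSpace ℝ (Fin 3))) :
    invPowSum 12 F - invPowSum 6 F = ∑ y ∈ F, siteVirial y F := by
  unfold invPowSum siteVirial
  rw [← Finset.sum_sub_distrib]
  exact Finset.sum_congr rfl fun y _ => (Finset.sum_sub_distrib _ _).symm

/-- Single sums over the enumeration are sums over the chunk. -/
theorem sum_enum (F : Finset (EuclideanSpace ℝ (Fin 3))) (f : EuclideanSpace ℝ (Fin 3) → ℝ) :
    ∑ k, f (enum F k) = ∑ w ∈ F, f w := by
  rw [Fintype.sum_equiv F.equivFin.symm (fun j => f (enum F j)) (fun c => f (c : EuclideanSpace ℝ (Fin 3))) (fun _ => rfl)]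
  exact Finset.sum_coe_sort F f

/-- Per-site shell sum in a `δ`-separated chunk: `Σ_{w ∈ F} |y − w|⁻⁶ ≤ 250 δ⁻⁶` for `y ∈ F` (Literature `sum_inv_pow_six_le`). -/
theorem sum_inv_pow_six_site_le {F : Finset (EuclideanSpace ℝ (Fin 3))} {δ : ℝ} (hδ : 0 < δ)
    (hsep : ∀ y ∈ F, ∀ w ∈ F, y ≠ w → δ ≤ dist y w) {y : EuclideanSpace ℝ (Fin 3)} (hy : y ∈ F) :
    ∑ w ∈ F, (dist y w)⁻¹ ^ 6 ≤ 250 * δ⁻¹ ^ 6 := by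
  have hsep' : ∀ k l : Fin F.card, k ≠ l → δ ≤ dist (enum F k) (enum F l) := fun k l hkl =>
    hsep _ (Finset.coe_mem _) _ (Finset.coe_mem _) fun h => hkl (enum_injective F h)
  set i : Fin F.card := F.equivFin ⟨y, hy⟩ with hi
  have hyi : enum F i = y := by
    rw [hi]
    simp [enum]
  have h1 : ∑ w ∈ F, (dist y w)⁻¹ ^ 6 = ∑ k, (dist y (enum F k))⁻¹ ^ 6 := (sum_enum F (fun w => (dist y w)⁻¹ ^ 6)).symm
  have h2 : ∑ k, (dist y (enum F k))⁻¹ ^ 6 = ∑ k ∈ Finset.univ.erase i, (dist (enum F i) (enum F k))⁻¹ ^ 6 := by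
    rw [hyi]
    exact (Finset.sum_erase _ (by rw [hyi, dist_self, inv_zero]; norm_num)).symm
  rw [h1, h2]
  exact sum_inv_pow_six_le (enum F) hδ hsep' i

/-- A site virial inside a `δ`-separated chunk is at least `−250 δ⁻⁶`. -/
theorem siteVirial_ge {F : Finset (EuclideanSpace ℝ (Fin 3))} {δ : ℝ} (hδ : 0 < δ)
    (hsep : ∀ y ∈ F, ∀ w ∈ F, y ≠ w → δ ≤ dist y w) {y : EuclideanSpace ℝ (Fin 3)} (hy : y ∈ F) :
    -(250 * δ⁻¹ ^ 6) ≤ siteVirial y F := by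
  unfold siteVirial
  rw [Finset.sum_sub_distrib]
  have h12 : 0 ≤ ∑ w ∈ F, (dist y w)⁻¹ ^ 12 := Finset.sum_nonneg fun w _ => by positivity
  linarith [sum_inv_pow_six_site_le hδ hsep hy]

/-- `S₁₂(F) ≤ 250 δ⁻¹²·#F` for a `δ`-separated chunk (ContactSaturationLadder's shell bound, re-indexed). -/
theorem invPowSum_twelve_le {F : Finset (EuclideanSpace ℝ (Fin 3))} {δ : ℝ} (hδ : 0 < δ)
    (hsep : ∀ y ∈ F, ∀ w ∈ F, y ≠ w → δ ≤ dist y w) : invPowSum 12 F ≤ 250 * δ⁻¹ ^ 12 * (F.card : ℝ) := by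
  have hsep' : ∀ k l : Fin F.card, k ≠ l → δ ≤ dist (enum F k) (enum F l) := fun k l hkl =>
    hsep _ (Finset.coe_mem _) _ (Finset.coe_mem _) fun h => hkl (enum_injective F h)
  have h := sum_inv_pow_twelve_le_of_separated (enum F) Finset.univ hδ hsep'
  rw [Finset.card_univ, Fintype.card_fin] at h
  have heq : invPowSum 12 F = ∑ i ∈ (Finset.univ : Finset (Fin F.card)), ∑ k ∈ Finset.univ.erase i,
      (dist (enum F i) (enum F k))⁻¹ ^ 12 := by
    unfold invPowSum
    rw [← sum_sum_enum F (fun a b => (dist a b)⁻¹ ^ 12)]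
    refine Finset.sum_congr rfl fun i _ => ?_
    exact (Finset.sum_erase _ (by rw [dist_self, inv_zero]; norm_num)).symm
  rw [heq]
  exact h

/-- A `δ`-separated set in a box with two sides `≤ ℓ` and one side `1` has at most `27 ℓ²/δ³` points (`δ ≤ 1 ≤ ℓ`). -/
theorem card_slab_le {S : Finset (EuclideanSpace ℝ (Fin 3))} {δ ℓ : ℝ} (hδ : 0 < δ) (hδ1 : δ ≤ 1) (hℓ : 1 ≤ ℓ) (i : Fin 3)
    (a : Fin 3 → ℝ) (hS : ∀ z ∈ S, ∀ j : Fin 3, a j ≤ z j ∧ z j < a j + Function.update (fun _ : Fin 3 => ℓ) i 1 j)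
    (hsep : ∀ z ∈ S, ∀ w ∈ S, z ≠ w → δ ≤ dist z w) : (S.card : ℝ) ≤ 27 * ℓ ^ 2 / δ ^ 3 := by
  set s : Fin 3 → ℝ := Function.update (fun _ : Fin 3 => ℓ) i 1 with hs
  have hsj : ∀ j, s j = 1 ∨ s j = ℓ := fun j => by
    by_cases hj : j = i
    · left; rw [hj]; simp [hs]
    · right; simp [hs, hj]
  have hs1 : ∀ j, 1 ≤ s j := fun j => by rcases hsj j with h | h <;> simp only [h, le_refl, hℓ]
  have hsℓ : ∀ j, s j ≤ ℓ := fun j => by rcases hsj j with h | h <;> simp only [h, le_refl, hℓ]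
  have hsi : s i = 1 := by simp [hs]
  have hbox := card_le_of_separated_of_box S a s hδ (fun j => by linarith [hs1 j]) hS
    (fun z hz w hw hzw => hsep z hz w hw hzw)
  have hf : ∀ j, 2 * s j / δ + 1 ≤ 3 * s j / δ := fun j => by
    rw [div_add_one hδ.ne', div_le_div_iff_of_pos_right hδ]
    linarith [hs1 j]
  have hprod : ∏ j, s j ≤ ℓ ^ 2 := by
    rw [← Finset.mul_prod_erase Finset.univ s (Finset.mem_univ i), hsi, one_mul]
    calc ∏ j ∈ Finset.univ.erase i, s j ≤ ∏ j ∈ Finset.univ.erase i, ℓ :=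
          Finset.prod_le_prod (fun j _ => by linarith [hs1 j]) (fun j _ => hsℓ j)
      _ = ℓ ^ 2 := by
          rw [Finset.prod_const, Finset.card_erase_of_mem (Finset.mem_univ i), Finset.card_univ, Fintype.card_fin]
  have hprod0 : 0 ≤ ∏ j, s j := Finset.prod_nonneg fun j _ => by linarith [hs1 j]
  calc (S.card : ℝ) ≤ ∏ j, (2 * s j / δ + 1) := hbox
    _ ≤ ∏ j, (3 * s j / δ) := Finset.prod_le_prod (fun j _ => by have := hs1 j; positivity) (fun j _ => hf j)
    _ = 27 * (∏ j, s j) / δ ^ 3 := by rw [Fin.prod_univ_three, Fin.prod_univ_three]; ring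
    _ ≤ 27 * ℓ ^ 2 / δ ^ 3 := by gcongr

/-- **Few face sites.**  In a `δ`-separated chunk of the half-open cube `Q(q, ℓ)` at most `162 ℓ²/δ³` points lie within `1` of a face
(`δ ≤ 1 ≤ ℓ`; six slabs). -/
theorem card_shallow_le {F : Finset (EuclideanSpace ℝ (Fin 3))} {q : EuclideanSpace ℝ (Fin 3)} {ℓ δ : ℝ} (hδ : 0 < δ) (hδ1 : δ ≤ 1)
    (hℓ : 1 ≤ ℓ) (hmem : ∀ z ∈ F, ∀ i : Fin 3, q i ≤ z i ∧ z i < q i + ℓ)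
    (hsep : ∀ z ∈ F, ∀ w ∈ F, z ≠ w → δ ≤ dist z w) :
    ((F.filter fun z => ¬ ∀ i : Fin 3, q i + 1 ≤ z i ∧ z i < q i + ℓ - 1).card : ℝ) ≤ 162 * ℓ ^ 2 / δ ^ 3 := by
  set low : Fin 3 → Finset (EuclideanSpace ℝ (Fin 3)) := fun i => F.filter fun z => z i < q i + 1 with hlow
  set high : Fin 3 → Finset (EuclideanSpace ℝ (Fin 3)) := fun i => F.filter fun z => q i + ℓ - 1 ≤ z i with hhigh
  have hsub : (F.filter fun z => ¬ ∀ i : Fin 3, q i + 1 ≤ z i ∧ z i < q i + ℓ - 1) ⊆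
      Finset.univ.biUnion fun i => low i ∪ high i := by
    intro z hz
    rw [Finset.mem_filter] at hz
    obtain ⟨hzF, hz⟩ := hz
    push Not at hz
    obtain ⟨i, hi⟩ := hz
    rw [Finset.mem_biUnion]
    refine ⟨i, Finset.mem_univ i, ?_⟩
    rw [Finset.mem_union]
    by_cases hl : z i < q i + 1
    · exact Or.inl (Finset.mem_filter.2 ⟨hzF, hl⟩)
    · push Not at hl
      exact Or.inr (Finset.mem_filter.2 ⟨hzF, hi hl⟩)
  have hlowc : ∀ i, ((low i).card : ℝ) ≤ 27 * ℓ ^ 2 / δ ^ 3 := by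
    intro i
    refine card_slab_le hδ hδ1 hℓ i (fun j => q j) (fun z hz j => ?_)
      (fun z hz w hw hzw => hsep z (Finset.mem_of_mem_filter z hz) w (Finset.mem_of_mem_filter w hw) hzw)
    have hzF : z ∈ F := Finset.mem_of_mem_filter z hz
    have hzi : z i < q i + 1 := (Finset.mem_filter.1 hz).2
    by_cases hj : j = i
    · subst hj
      rw [Function.update_self]
      exact ⟨(hmem z hzF j).1, hzi⟩
    · rw [Function.update_of_ne hj]
      exact hmem z hzF j
  have hhighc : ∀ i, ((high i).card : ℝ) ≤ 27 * ℓ ^ 2 / δ ^ 3 := by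
    intro i
    refine card_slab_le hδ hδ1 hℓ i (Function.update (fun j => q j) i (q i + ℓ - 1)) (fun z hz j => ?_)
      (fun z hz w hw hzw => hsep z (Finset.mem_of_mem_filter z hz) w (Finset.mem_of_mem_filter w hw) hzw)
    have hzF : z ∈ F := Finset.mem_of_mem_filter z hz
    have hzi : q i + ℓ - 1 ≤ z i := (Finset.mem_filter.1 hz).2
    by_cases hj : j = i
    · subst hj
      rw [Function.update_self, Function.update_self]
      exact ⟨hzi, by linarith [(hmem z hzF j).2]⟩
    · rw [Function.update_of_ne hj, Function.update_of_ne hj]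
      exact hmem z hzF j
  have h1 : ((F.filter fun z => ¬ ∀ i : Fin 3, q i + 1 ≤ z i ∧ z i < q i + ℓ - 1).card : ℝ) ≤
      ∑ i : Fin 3, (((low i).card : ℝ) + (high i).card) := by
    have hn : (F.filter fun z => ¬ ∀ i : Fin 3, q i + 1 ≤ z i ∧ z i < q i + ℓ - 1).card ≤
        ∑ i : Fin 3, ((low i).card + (high i).card) :=
      (Finset.card_le_card hsub).trans
        (Finset.card_biUnion_le.trans (Finset.sum_le_sum fun i _ => Finset.card_union_le _ _))
    exact_mod_cast hn
  calc ((F.filter fun z => ¬ ∀ i : Fin 3, q i + 1 ≤ z i ∧ z i < q i + ℓ - 1).card : ℝ)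
      ≤ ∑ i : Fin 3, (((low i).card : ℝ) + (high i).card) := h1
    _ ≤ ∑ _i : Fin 3, (54 * ℓ ^ 2 / δ ^ 3) := Finset.sum_le_sum fun i _ => by
          have h1 := hlowc i
          have h2 := hhighc i
          have h3 : (27 : ℝ) * ℓ ^ 2 / δ ^ 3 + 27 * ℓ ^ 2 / δ ^ 3 = 54 * ℓ ^ 2 / δ ^ 3 := by ring
          linarith
    _ = 162 * ℓ ^ 2 / δ ^ 3 := by rw [Finset.sum_const, Finset.card_univ, Fintype.card_fin, nsmul_eq_mul]; ring

/-- **Many deep sites.**  If every point of space is within `9/10` of `Y` and `F` contains all of `Y` in the cube `Q(q, 2m+3)`, then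
at least `m³` points of `F` are `1`-deep (the `Y`-points nearest to the `2`-grid `q + 2 + 2k`, `k ∈ {0,…,m−1}³`, are distinct and deep). -/
theorem le_card_deep {Y : Set (EuclideanSpace ℝ (Fin 3))} (hcov : ∀ z : EuclideanSpace ℝ (Fin 3), ∃ w ∈ Y, dist z w ≤ 9 / 10)
    (q : EuclideanSpace ℝ (Fin 3)) (m : ℕ) (F : Finset (EuclideanSpace ℝ (Fin 3)))
    (hF : ∀ z ∈ Y, (∀ i : Fin 3, q i ≤ z i ∧ z i < q i + (2 * m + 3)) → z ∈ F) :
    (m : ℝ) ^ 3 ≤ ((F.filter fun z => ∀ i : Fin 3, q i + 1 ≤ z i ∧ z i < q i + (2 * m + 3) - 1).card : ℝ) := by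
  set g : (Fin 3 → Fin m) → EuclideanSpace ℝ (Fin 3) :=
    fun k => q + WithLp.toLp 2 (fun i => 2 + 2 * ((k i : ℕ) : ℝ)) with hg
  have hgi : ∀ k i, g k i = q i + (2 + 2 * ((k i : ℕ) : ℝ)) := by intro k i; simp [hg]
  choose w hwY hwd using fun k => hcov (g k)
  have hco : ∀ k i, -(9 / 10 : ℝ) ≤ w k i - g k i ∧ w k i - g k i ≤ 9 / 10 := by
    intro k i
    have hwd' : dist (w k) (g k) ≤ 9 / 10 := by rw [dist_comm]; exact hwd k
    have h : dist (w k i) (g k i) ≤ 9 / 10 := (PiLp.dist_apply_le (w k) (g k) i).trans hwd'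
    rw [Real.dist_eq, abs_le] at h
    exact h
  have hkm : ∀ (k : Fin 3 → Fin m) (i : Fin 3), ((k i : ℕ) : ℝ) + 1 ≤ m := fun k i => by
    have h : (k i : ℕ) + 1 ≤ m := (k i).isLt
    exact_mod_cast h
  have hdeep : ∀ k, w k ∈ F.filter fun z => ∀ i : Fin 3, q i + 1 ≤ z i ∧ z i < q i + (2 * m + 3) - 1 := by
    intro k
    have hb : ∀ i : Fin 3, q i + 1 ≤ w k i ∧ w k i < q i + (2 * m + 3) - 1 := by
      intro i
      have h1 := hco k i
      have h2 := hgi k i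
      have h3 := hkm k i
      have h0 : (0 : ℝ) ≤ ((k i : ℕ) : ℝ) := Nat.cast_nonneg _
      constructor <;> linarith [h1.1, h1.2]
    rw [Finset.mem_filter]
    exact ⟨hF _ (hwY k) fun i => ⟨by linarith [(hb i).1], by linarith [(hb i).2]⟩, hb⟩
  have hinj : Function.Injective w := by
    intro k k' hkk'
    by_contra hne
    obtain ⟨i, hi⟩ := Function.ne_iff.1 hne
    have hi' : (k i : ℕ) ≠ (k' i : ℕ) := fun h => hi (Fin.ext h)
    have e : g k i - g k' i = (g k i - w k i) + (w k' i - g k' i) := by rw [hkk']; ring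
    have hb : -(9 / 5 : ℝ) ≤ g k i - g k' i ∧ g k i - g k' i ≤ 9 / 5 := by
      have h1 := hco k i
      have h2 := hco k' i
      rw [e]
      constructor <;> linarith [h1.1, h1.2, h2.1, h2.2]
    have hd : g k i - g k' i = 2 * (((k i : ℕ) : ℝ) - ((k' i : ℕ) : ℝ)) := by rw [hgi, hgi]; ring
    rcases lt_or_gt_of_ne hi' with hlt | hlt
    · have h : ((k i : ℕ) : ℝ) + 1 ≤ ((k' i : ℕ) : ℝ) := by exact_mod_cast hlt
      linarith [hb.1]
    · have h : ((k' i : ℕ) : ℝ) + 1 ≤ ((k i : ℕ) : ℝ) := by exact_mod_cast hlt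
      linarith [hb.2]
  have hmaps : Set.MapsTo w ↑(Finset.univ : Finset (Fin 3 → Fin m))
      ↑(F.filter fun z => ∀ i : Fin 3, q i + 1 ≤ z i ∧ z i < q i + (2 * m + 3) - 1) := by
    intro k _; rw [Finset.mem_coe]; exact hdeep k
  have hinj' : Set.InjOn w ↑(Finset.univ : Finset (Fin 3 → Fin m)) := by intro k _ k' _ hkk'; exact hinj hkk'
  have hcard : (Finset.univ : Finset (Fin 3 → Fin m)).card ≤
      (F.filter fun z => ∀ i : Fin 3, q i + 1 ≤ z i ∧ z i < q i + (2 * m + 3) - 1).card :=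
    Finset.card_le_card_of_injOn w hmaps hinj'
  have hu : (Finset.univ : Finset (Fin 3 → Fin m)).card = m ^ 3 := by
    rw [Finset.card_univ, Fintype.card_fun, Fintype.card_fin, Fintype.card_fin]
  rw [hu] at hcard
  exact_mod_cast hcard

/-- **`LocalVirialInequality ⟹ CompressedVirialLaw`** (PROVED bookkeeping): a per-site virial floor `c > 0` on the compressed clean class
gives cofinal cubes with dilation gain `≥ κ ℓ³`, `κ = (c/128)² δ¹⁵ / (24·250·27)` at separation `δ ≤ 1`. [this file] -/
theorem compressedVirialLaw_of_localVirial {T₀ D c : ℝ} (hc : 0 < c) (h : LocalVirialInequality T₀ D c) :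
    CompressedVirialLaw T₀ D := by
  intro Y hY hcs
  obtain ⟨δ₀, hδ₀, hsep₀⟩ := hY.1
  set δ : ℝ := min δ₀ 1 with hδdef
  have hδ : 0 < δ := lt_min hδ₀ one_pos
  have hδ1 : δ ≤ 1 := min_le_right _ _
  have hsep : ∀ p ∈ Y, ∀ p' ∈ Y, p ≠ p' → δ ≤ dist p p' :=
    fun p hp p' hp' hpp' => (min_le_left _ _).trans (hsep₀ p hp p' hp' hpp')
  have hUD : UniformlyDiscrete Y := ⟨δ, hδ, hsep⟩
  have hcov : ∀ z : EuclideanSpace ℝ (Fin 3), ∃ w ∈ Y, dist z w ≤ 9 / 10 := hY.2.2.2.1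
  set A : ℝ := 162 / δ ^ 3 with hA
  set B : ℝ := 27 / δ ^ 3 with hB
  set M : ℝ := 250 * δ⁻¹ ^ 6 with hM
  set Dd : ℝ := 250 * δ⁻¹ ^ 12 * B with hDd
  have hMpos : 0 < M := by positivity
  have hDpos : 0 < Dd := by positivity
  set κ : ℝ := (c / 128) ^ 2 / (24 * Dd) with hκ
  refine ⟨κ, by positivity, ?_⟩
  intro ℓ₀
  obtain ⟨m, hm⟩ := exists_nat_ge (max ℓ₀ (max 6 (128 * M * A / c)) / 2)
  set ℓ : ℝ := 2 * (m : ℝ) + 3 with hℓ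
  have hmax : max ℓ₀ (max 6 (128 * M * A / c)) ≤ ℓ := by
    have : max ℓ₀ (max 6 (128 * M * A / c)) ≤ 2 * (m : ℝ) := by linarith
    linarith
  have hℓ₀ : ℓ₀ ≤ ℓ := (le_max_left _ _).trans hmax
  have hℓ6 : 6 ≤ ℓ := le_trans (le_trans (le_max_left _ _) (le_max_right _ _)) hmax
  have hℓA : 128 * M * A / c ≤ ℓ := le_trans (le_trans (le_max_right _ _) (le_max_right _ _)) hmax
  have hℓ1 : 1 ≤ ℓ := by linarith
  have hℓpos : 0 < ℓ := by linarith
  obtain ⟨q, -⟩ : ∃ q : EuclideanSpace ℝ (Fin 3), True := ⟨0, trivial⟩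
  have hfin := finite_inter_cube hUD q hℓpos.le
  set F : Finset (EuclideanSpace ℝ (Fin 3)) := hfin.toFinset with hFdef
  have hFcoe : (↑F : Set (EuclideanSpace ℝ (Fin 3))) = Y ∩ {z | ∀ i : Fin 3, q i ≤ z i ∧ z i < q i + ℓ} :=
    Set.Finite.coe_toFinset hfin
  have hmemF : ∀ z, z ∈ F ↔ z ∈ Y ∧ ∀ i : Fin 3, q i ≤ z i ∧ z i < q i + ℓ := fun z => by
    rw [hFdef, Set.Finite.mem_toFinset]; rfl
  have hFY : ∀ z ∈ F, z ∈ Y := fun z hz => ((hmemF z).1 hz).1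
  have hFcube : ∀ z ∈ F, ∀ i : Fin 3, q i ≤ z i ∧ z i < q i + ℓ := fun z hz => ((hmemF z).1 hz).2
  have hFsub : (↑F : Set (EuclideanSpace ℝ (Fin 3))) ⊆ Y := fun z hz => hFY z hz
  have hsepF : ∀ z ∈ F, ∀ z' ∈ F, z ≠ z' → δ ≤ dist z z' := fun z hz z' hz' hzz' => hsep z (hFY z hz) z' (hFY z' hz') hzz'
  set P : EuclideanSpace ℝ (Fin 3) → Prop := fun z => ∀ i : Fin 3, q i + 1 ≤ z i ∧ z i < q i + ℓ - 1 with hP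
  have hdeepV : ∀ y ∈ F.filter P, c ≤ siteVirial y F := by
    intro y hy
    have hyF : y ∈ F := Finset.mem_of_mem_filter y hy
    have hyP : P y := (Finset.mem_filter.1 hy).2
    refine h Y hY hcs y (hFY y hyF) F hFsub fun w' hw' hd => ?_
    rw [hmemF]
    refine ⟨hw', fun i => ?_⟩
    have hi := (PiLp.dist_apply_le y w' i).trans hd
    rw [Real.dist_eq, abs_le] at hi
    have hy1 := hyP i
    constructor <;> linarith [hi.1, hi.2, hy1.1, hy1.2]
  have hshallowV : ∀ y ∈ F.filter (fun z => ¬ P z), -M ≤ siteVirial y F :=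
    fun y hy => siteVirial_ge hδ hsepF (Finset.mem_of_mem_filter y hy)
  have hdeepN : (m : ℝ) ^ 3 ≤ ((F.filter P).card : ℝ) := by
    have h3 : (2 * (m : ℝ) + 3) = ℓ := by rw [hℓ]
    have := le_card_deep hcov q m F (fun z hz hzc => (hmemF z).2 ⟨hz, by rw [← h3]; exact hzc⟩)
    simpa only [h3] using this
  have hshallowN : ((F.filter (fun z => ¬ P z)).card : ℝ) ≤ A * ℓ ^ 2 := by
    have := card_shallow_le hδ hδ1 hℓ1 hFcube hsepF
    rw [hA]
    calc ((F.filter (fun z => ¬ P z)).card : ℝ) ≤ 162 * ℓ ^ 2 / δ ^ 3 := this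
      _ = 162 / δ ^ 3 * ℓ ^ 2 := by ring
  have hS : invPowSum 12 F - invPowSum 6 F = ∑ y ∈ F, siteVirial y F := invPowSum_sub_eq_sum_siteVirial F
  have hsplit : ∑ y ∈ F, siteVirial y F = ∑ y ∈ F.filter P, siteVirial y F + ∑ y ∈ F.filter (fun z => ¬ P z), siteVirial y F :=
    (Finset.sum_filter_add_sum_filter_not F P _).symm
  have hdeepS : ((F.filter P).card : ℝ) * c ≤ ∑ y ∈ F.filter P, siteVirial y F := by
    have := Finset.card_nsmul_le_sum (F.filter P) (fun y => siteVirial y F) c hdeepV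
    rwa [nsmul_eq_mul] at this
  have hshallowS : ((F.filter (fun z => ¬ P z)).card : ℝ) * (-M) ≤ ∑ y ∈ F.filter (fun z => ¬ P z), siteVirial y F := by
    have := Finset.card_nsmul_le_sum (F.filter (fun z => ¬ P z)) (fun y => siteVirial y F) (-M) hshallowV
    rwa [nsmul_eq_mul] at this
  have hm4 : ℓ / 4 ≤ (m : ℝ) := by rw [hℓ] at hℓ6 ⊢; linarith
  have hm3 : ℓ ^ 3 / 64 ≤ (m : ℝ) ^ 3 := by
    have := pow_le_pow_left₀ (by positivity) hm4 3
    calc ℓ ^ 3 / 64 = (ℓ / 4) ^ 3 := by ring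
      _ ≤ (m : ℝ) ^ 3 := this
  have hMA : M * A * ℓ ^ 2 ≤ c * ℓ ^ 3 / 128 := by
    have h1 : 128 * M * A ≤ c * ℓ := by
      rw [div_le_iff₀ hc] at hℓA
      linarith
    have h2 : 0 ≤ ℓ ^ 2 := by positivity
    nlinarith
  have hV : c * ℓ ^ 3 / 128 ≤ invPowSum 12 F - invPowSum 6 F := by
    rw [hS, hsplit]
    have h1 : c * (ℓ ^ 3 / 64) ≤ ((F.filter P).card : ℝ) * c := by nlinarith [hdeepN, hm3, hc.le]
    have h2 : -(M * A * ℓ ^ 2) ≤ ((F.filter (fun z => ¬ P z)).card : ℝ) * (-M) := by nlinarith [hshallowN, hMpos.le]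
    linarith
  have hVpos : 0 < invPowSum 12 F - invPowSum 6 F := lt_of_lt_of_le (by positivity) hV
  have h6nn : 0 ≤ invPowSum 6 F := by
    unfold invPowSum
    exact Finset.sum_nonneg fun y _ => Finset.sum_nonneg fun w _ => by positivity
  have h12pos : 0 < invPowSum 12 F := by linarith
  have hNB : (F.card : ℝ) ≤ B * ℓ ^ 3 := by
    have hbox := card_le_of_separated_of_box F (fun i => q i) (fun _ => ℓ) hδ (fun _ => hℓpos.le) hFcube hsepF
    rw [Finset.prod_const, Finset.card_univ, Fintype.card_fin] at hbox
    have h3 : 2 * ℓ / δ + 1 ≤ 3 * ℓ / δ := by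
      rw [div_add_one (ne_of_gt hδ), div_le_div_iff_of_pos_right hδ]
      linarith
    have h4 : (2 * ℓ / δ + 1) ^ 3 ≤ (3 * ℓ / δ) ^ 3 := pow_le_pow_left₀ (by positivity) h3 3
    calc (F.card : ℝ) ≤ (2 * ℓ / δ + 1) ^ 3 := hbox
      _ ≤ (3 * ℓ / δ) ^ 3 := h4
      _ = B * ℓ ^ 3 := by rw [hB]; field_simp; ring
  have h12le : invPowSum 12 F ≤ Dd * ℓ ^ 3 := by
    calc invPowSum 12 F ≤ 250 * δ⁻¹ ^ 12 * (F.card : ℝ) := invPowSum_twelve_le hδ hsepF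
      _ ≤ 250 * δ⁻¹ ^ 12 * (B * ℓ ^ 3) := mul_le_mul_of_nonneg_left hNB (by positivity)
      _ = Dd * ℓ ^ 3 := by rw [hDd]; ring
  refine ⟨ℓ, hℓ₀, q, F, hFcoe, ?_⟩
  unfold dilationGain
  rw [le_div_iff₀ (by positivity)]
  have h1 : κ * ℓ ^ 3 * (24 * invPowSum 12 F) ≤ κ * ℓ ^ 3 * (24 * (Dd * ℓ ^ 3)) :=
    mul_le_mul_of_nonneg_left (by linarith) (by positivity)
  have h2 : κ * ℓ ^ 3 * (24 * (Dd * ℓ ^ 3)) = (c * ℓ ^ 3 / 128) ^ 2 := by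
    rw [hκ]
    field_simp
    try ring
  have h3 : (c * ℓ ^ 3 / 128) ^ 2 ≤ (invPowSum 12 F - invPowSum 6 F) ^ 2 := pow_le_pow_left₀ (by positivity) hV 2
  linarith

/-- `LocalVirialLaw ⟹ CompressedVirialLaw`. [this file] -/
theorem compressedVirialLaw_of_localVirialLaw {T₀ D : ℝ} (h : LocalVirialLaw T₀ D) : CompressedVirialLaw T₀ D := by
  obtain ⟨c, hc, h⟩ := h
  exact compressedVirialLaw_of_localVirial hc h

/-- **The g27 cone with the EOS branch in per-site form (record parameters)**: `GrossCleanBallsU (1/250) 10 → ChargedEnergyGap →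
LocalRelaxationTest (1/250) 10 → LocalVirialLaw (1/250) 10 → ShearFreeLiouvilleLaw (1/250) 10 → CleanlessExcessT → CoherentResidual 10 →
RobustDefectLimitWindows`. [this file] -/
theorem rdef_of_grossU_localVirial_record (hG : GrossCleanBallsU (1 / 250) 10) (hCEG : ChargedEnergyGap)
    (hL : LocalRelaxationTest (1 / 250) 10) (hV : LocalVirialLaw (1 / 250) 10) (hS : ShearFreeLiouvilleLaw (1 / 250) 10)
    (hCE : CleanlessExcessT) (hR : CoherentResidual 10) : RobustDefectLimitWindows :=
  rdef_of_grossU_shearSplit_record hG hCEG hL (compressedVirialLaw_of_localVirialLaw hV) hS hCE hR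

end Summit.AtomisticToContinuum.Crystallization.Theorems.OverbindingBudgetElasticSplitLocalVirial
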